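import Summits.ABC.IUTFork.Joshi.AdelicAnsatzLocalSupply
import Summits.ABC.IUTFork.Joshi.AdelicAnsatzScaling
import HarnessLib

/-!
# [J-III] Thm. 4.2.2.1 (4) ⟹ (9.9.4) and «no valuation-diagonal Ansatz component» ALONG A GLUING CERTIFICATE: E-t7's
# `Joshi/AdelicAnsatzScaling.lean` chain with all its binders supplied from E-t3's prototype datum

Proof-only sequel (abc-iut cell, block E «type Joshi's construction, test vs S», rung LADDER-ABC:A2.E; seat abc-iut-E-t57, batch-3
«[J-IIp] DERIVABLE/SUPPLIER seat») of `Joshi/AdelicAnsatzLocalSupply.lean` (this seat, p432358: the certificate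
`AdelicCurveDatum.PrototypeSupply` and `valuationScaling` / `absK_pos` / `absK_ne_one` along it) and of abc-iut-E-t7's
`Joshi/AdelicAnsatzScaling.lean` (p429452 + append: `absK_eq_rpow_scalingExponent`, `not_valuationDiagonal_of_valuationScaling`, which take
`ValuationScaling`, a positivity and a `≠ 1` binder as hypotheses). These are the two corollaries ANNOUNCED in p432358's module docstring
§3 and deferred there because E-t7's append was ahead of the farm build at filing time; a separate file rather than an append because
adding the import `Joshi.AdelicAnsatzScaling` to p432358 relocates an auto-generated equation lemma (`AdelicCurveDatum.jOne.eq_1`) and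
trips the append-only check. SOURCES: K. Joshi, arXiv:2401.13508v4 = [J-III] (unrefereed; bib `Joshi2024ATS3`), Thm. 4.2.2.1 (4) p.33
l.3–36 and (9.9.4) p.121 l.1–12; arXiv:2303.01662v3 = [J-IIp] (bib `Joshi2023ATS2Local`), Thm. 6.9.1. TAKES NO SIDE on [IUTchIII]
Cor. 3.12, on Joshi's claims or on Mochizuki's report; typed ≠ proved ≠ endorsed. Object-side (E-PLAN R14: Joshi imports only); no
FACT-LIST row, no new `Prop`, nothing asserted.
-/

noncomputable section

namespace Summit.ABC.IUTFork.Joshi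

namespace AdelicCurveDatum.PrototypeSupply

variable {D : AdelicCurveDatum}
variable {F B E0 : D.P → Type} [∀ p, Field (F p)] [∀ p, CommRing (B p)] [∀ p, Field (E0 p)]
  {K : (p : D.P) → D.Y0 p → Type} [∀ p (y : D.Y0 p), Field (K p y)] (σ : D.PrototypeSupply F B E0 K)

include σ

/-- **Thm. 4.2.2.1 (4) ⟹ (9.9.4), exponent form, along a certificate**: for `z ∈ Σ̃_{L′}`, `w ∈ V^{odd,ss}` and `t` with
`e(t) ≠ 0` in `Ē`: `|t|_{K′_{w,j}} = |t|_{K′_{w,ℓ*}} ^ (j/ℓ*)²` — E-t7's `absK_eq_rpow_scalingExponent` (the renormalisation step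
«(9.9.3) ⟹ (9.9.4)» that seat E-t23's `LogVolumesHullsScaling` names as its T-07 input) with BOTH binders supplied: `ValuationScaling`
by `PrototypeSupply.valuationScaling` ([J-IIp] Thm. 6.9.1 via E-t3's `scale_ansatzPt`) and positivity by `absK_pos`.
[claim: Joshi2024ATS3, status: disputed] -/
theorem absK_eq_rpow_scalingExponent {z : D.Tuple} (hz : z ∈ D.adelicAnsatz) {w : D.V} (hw : w ∈ D.oddss)
    {t : D.T (D.pOf w)} (ht : σ.toE0 (D.pOf w) t ≠ 0) (i : Fin D.lstar) :
    D.absK w (z i w) t = D.absK w (z D.jLast w) t ^ ATS3.LocusDatum.scalingExponent D.lstar i :=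
  D.absK_eq_rpow_scalingExponent σ.valuationScaling hz hw t (σ.absK_pos _ ht) i

/-- **No valuation-diagonal Ansatz component at a bad place, along a certificate**: for `z ∈ Σ̃_{L′}`, `w ∈ V^{odd,ss}`, `ℓ* ≥ 2` and
`t` with `e(t) ≠ 0`, `|e(t)|_0 ≠ 1` in `Ē`, the residue valuations `|t|_{K′_{w,j}}`, `j = 1, …, ℓ*`, are NOT all equal — E-t7's
`not_valuationDiagonal_of_valuationScaling` (the Joshi-side shadow of the separation «`(q, …, q)` is no translate of `(q, q⁴, …, q^{(ℓ*)²})`»,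
OUR `Cor312PinnedCountermodel.orbitRegion_separates` by name only) with all three binders supplied (`valuationScaling`, `absK_pos`,
`absK_ne_one`). [claim: Joshi2024ATS3, status: disputed] -/
theorem not_valuationDiagonal (hl : 2 ≤ D.lstar) {z : D.Tuple} (hz : z ∈ D.adelicAnsatz) {w : D.V} (hw : w ∈ D.oddss)
    {t : D.T (D.pOf w)} (ht : σ.toE0 (D.pOf w) t ≠ 0) (ht1 : (σ.proto (D.pOf w)).abs0 (σ.toE0 (D.pOf w) t) ≠ 1) :
    ¬ ∀ i : Fin D.lstar, D.absK w (z i w) t = D.absK w (z D.jOne w) t :=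
  D.not_valuationDiagonal_of_valuationScaling σ.valuationScaling hl hz hw t (σ.absK_pos _ ht) (σ.absK_ne_one _ ht ht1)

end AdelicCurveDatum.PrototypeSupply

namespace PrototypeFamily

variable {P : Type} {F B E0 Y0 : P → Type} [∀ p, Field (F p)] [∀ p, CommRing (B p)] [∀ p, Field (E0 p)]
  {K : (p : P) → Y0 p → Type} [∀ p (y : Y0 p), Field (K p y)] {G0 : P → Type}
  (Φ : PrototypeFamily P F B E0 Y0 K G0) (oddss : Set P)

/-- For the «local = global» datum of a prototype family (p432358 §4), in which the evaluation domain IS `Ē` (`toE0 = id`): at a bad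
prime `w`, for `ℓ* ≥ 2`, every Ansatz point and every `z ∈ Ē` with `0 ≠ |z|_0 ≠ 1`, the residue valuations `|ι(z)|_{K_{w,j}}` are not all
equal — [J-III] Thm. 4.2.2.1 (4)'s scaling is GENUINE there, with no hypothesis beyond E-t3's signature and the two binders.
[claim: Joshi2024ATS3, status: disputed] -/
theorem toAdelicCurveDatum_not_valuationDiagonal (hl : 2 ≤ Φ.lstar) {z : (Φ.toAdelicCurveDatum oddss).Tuple}
    (hz : z ∈ (Φ.toAdelicCurveDatum oddss).adelicAnsatz) {w : P} (hw : w ∈ oddss) {t : E0 w}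
    (ht : t ≠ 0) (ht1 : (Φ.proto w).abs0 t ≠ 1) :
    ¬ ∀ i : Fin Φ.lstar, (Φ.toAdelicCurveDatum oddss).absK w (z i w) t =
        (Φ.toAdelicCurveDatum oddss).absK w (z (Φ.toAdelicCurveDatum oddss).jOne w) t :=
  (Φ.supply oddss).not_valuationDiagonal hl hz hw ht ht1

end PrototypeFamily

end Summit.ABC.IUTFork.Joshi

end
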